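import Summits.BirchSwinnertonDyer.BirchSwinnertonDyer.Theorems.Rank2Observatory2DescClRowCertLe
import HarnessLib

/-!
# BirchSwinnertonDyer — rank ≥ 2 observatory: KERNEL-2DESC-CL v2 — the ONE-VIEW `r`-checker with an EXTRA SIEVE CONJUNCT (`…ClRowCertLeX`)

HONEST FRAMING: per-curve certified theorems and census instruments; no claim on BSD in rank ≥ 2.

The host-side half of the NODAL LOCAL-IMAGE ROW on the one-view class-group-general stack `…ClCurveCert` /
`…ClRowCertLe` (MONOGENIC-pair host: field record `ClFieldCert`, per-curve record `ClCurveCert`, family `fam`,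
sieve `adm`; used by cert-1's even-`h` CL sets and cert-3's ODDH-M / ODDMONO lanes): the core clauses `checkLeCore`
(= `checkLe r` without its survivor count) and **`rank_le_of_checkLeX`** — the landed `rank_le_of_checkLe_cl`
generalised ONCE by an extra admissibility conjunct `extra U` on the sieve, with its pointwise soundness stated over
the characterising equations of `e = θ_E = lin t` and of the family `W_j = lin g_j` (`W_j ≠ 0`, `F(e) = 0`, `y ≠ 0`
at the rational point), and the strict survivor count of `adm ∧ extra` `< 2 ^ (r + 1)`.  The proof is the landed
proof verbatim except at the three places the conjunct enters (empty set, the rational point, the count) — the third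
twin of the landed `…ClRealCertE2X` / `…ClCurveCertE2X`; nodal consumer: `…ClCurveCertLN`.
Sorry-free; axioms `propext`, `Classical.choice`, `Quot.sound`.
[cite: Cassels1991LecturesEllipticCurves, §15] [cite: CremonaAlgorithms1997, §3.6] [cite: Cohen1993, §4.8.2, §6.5]
-/

set_option linter.dupNamespace false

noncomputable section

open scoped NumberField nonZeroDivisors

open Literature.NumberTheory.NumberFields Polynomial Module NumberField IsDedekindDomain Ideal

namespace Summit.BirchSwinnertonDyer.BirchSwinnertonDyer.Rank2Observatory.TwoDescCl

open TwoDescCubic ClFieldCert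

/-! ## The core clauses -/

/-- The CORE clauses of the one-view `r`-checker: `checkLe r fc cc` without its final survivor count. -/
def checkLeCore (fc : ClFieldCert) (cc : ClCurveCert) : Bool :=
  decide (deltaShort cc.A cc.B cc.C ≠ 0) &&
    noRootMod cc.pF cc.A cc.B cc.C &&
    decide (cubicAtCoords fc.a fc.b fc.c cc.A cc.B cc.C cc.t = (0, 0, 0)) &&
    decide (derivAtCoords fc.a fc.b fc.c cc.A cc.B cc.t =
      MonicCubic.mulCoords fc.a fc.b fc.c cc.D (prodPowCoords fc.a fc.b fc.c [])) &&
    decide (MonicCubic.disc cc.A cc.B cc.C < 0) &&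
    decide (normFormZ fc.a fc.b fc.c cc.D.1 cc.D.2.1 cc.D.2.2 ≠ 0) &&
    decide ((normFormZ fc.a fc.b fc.c cc.D.1 cc.D.2.1 cc.D.2.2).natAbs = (cc.dn.map fun pe => pe.1 ^ pe.2).prod) &&
    (cc.dn.all fun pe => (fc.primes.any fun e => e.p == pe.1) &&
      ((fc.row pe.1).codes.all fun C' => decide (C' ∈ cc.codes) ||
        cc.dinv.any fun ci => ci.1 == C' && invCert fc.a fc.b fc.c C' cc.D ci.2)) &&
    (cc.codes.all fun C => (fc.primes.any fun e => e.p == C.1) && decide (C ∈ (fc.row C.1).codes)) &&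
    invCert fc.a fc.b fc.c fc.w₁ cc.D cc.dW1 && invCert fc.a fc.b fc.c fc.w₂ cc.D cc.dW2 &&
    (cc.Q.all fun q => decide (0 < q)) &&
    ((fam fc cc).all fun f => famCheck fc cc.D f) &&
    decide (∀ T : Finset (Fin (fam fc cc).length), T ≠ ∅ →
      ∃ k : Fin (fc.chars.length + 3), Odd (T.filter fun j => bit fc cc k j = true).card)

/-! ## Soundness -/

section Sound

variable {K : Type*} [Field K] [NumberField K] {θ : K}

/-- **Soundness of the one-view `r`-checker with an extra sieve conjunct: `rank E(ℚ) ≤ r`.**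
The core clauses `checkLeCore`, an extra conjunct `extra` sound at rational points (hypothesis `hextra`, over the
characterising equations of `e = θ_E` and the family `W`), and the strict count of survivors of `adm ∧ extra`.
[cite: Cassels1991LecturesEllipticCurves, §15] [cite: CremonaAlgorithms1997, §3.6] -/
theorem rank_le_of_checkLeX (r : ℕ) (fc : ClFieldCert) (hθ : aeval θ (MonicCubic.poly fc.a fc.b fc.c) = 0)
    (h3 : finrank ℚ K = 3) (hF : fc.check = true) (hpr : fc.primeList.Forall Nat.Prime) (cc : ClCurveCert)
    (hc : checkLeCore fc cc = true)
    (extra : Finset (Fin (fam fc cc).length) → Bool) (hextra0 : extra ∅ = true)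
    (hextra : ∀ (e : 𝓞 K) (W : Fin (fam fc cc).length → 𝓞 K), e = lin hθ cc.t.1 cc.t.2.1 cc.t.2.2 →
      (∀ j, W j = lin hθ ((fam fc cc).get j).2.2.g.1 ((fam fc cc).get j).2.2.g.2.1 ((fam fc cc).get j).2.2.g.2.2) →
      (∀ j, W j ≠ 0) → e ^ 3 + cc.A * e ^ 2 + cc.B * e + cc.C = 0 →
      ∀ x y : ℚ, y ^ 2 = x ^ 3 + cc.A * x ^ 2 + cc.B * x + cc.C → y ≠ 0 →
      ∀ U : Finset (Fin (fam fc cc).length),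
        IsSquare ((algebraMap ℚ K x - algebraMap (𝓞 K) K e) * ∏ j ∈ U, algebraMap (𝓞 K) K (W j)) →
        extra U = true)
    (hcount : ((Finset.univ ×ˢ Finset.univ).filter
      (fun p : Finset (Fin 0) × Finset (Fin (fam fc cc).length) => (adm fc cc p.1 p.2 && extra p.2) = true)).card <
      2 ^ (r + 1)) :
    ((⟨0, cc.A, 0, cc.B, cc.C⟩ : WeierstrassCurve ℚ)).mordellWeilRank ≤ r := by
  classical
  have hirr := fc.irreducible_of_check hF
  have hq := fc.q_prime hpr
  simp only [checkLeCore, Bool.and_eq_true, decide_eq_true_eq, List.all_eq_true, List.any_eq_true,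
    Bool.or_eq_true, beq_iff_eq] at hc
  obtain ⟨⟨⟨⟨⟨⟨⟨⟨⟨⟨⟨⟨⟨hΔ, hirrF⟩, hcub⟩, hder⟩, hdisc⟩, hND0⟩, hdn⟩, hdnC⟩, hcodes⟩, hdW1⟩, hdW2⟩, hQ⟩,
    hfamAll⟩, hcert⟩ := hc
  haveI hE := isElliptic_of_deltaShort_ne hΔ
  have hirrF' := irreducible_of_noRootMod hirrF
  -- `θ_E`, `D`, `M = D·q`
  have haev := aeval_lin_eq_zero_of_coords hθ cc.t hcub
  have hderiv : (3 : 𝓞 K) * (lin hθ cc.t.1 cc.t.2.1 cc.t.2.2) ^ 2 +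
      2 * ((cc.A : ℤ) : 𝓞 K) * (lin hθ cc.t.1 cc.t.2.1 cc.t.2.2) + ((cc.B : ℤ) : 𝓞 K) =
        lin hθ cc.D.1 cc.D.2.1 cc.D.2.2 := by
    simpa using deriv_eq_of_coords hθ cc.t cc.D [] hder
  have hD0 : (lin hθ cc.D.1 cc.D.2.1 cc.D.2.2 : 𝓞 K) ≠ 0 := lin_ne_zero_of_coords hirr hθ h3 _ hND0
  have hq0 : ((fc.q : ℕ) : 𝓞 K) ≠ 0 := by exact_mod_cast hq.ne_zero
  have hM0 : (lin hθ cc.D.1 cc.D.2.1 cc.D.2.2 : 𝓞 K) * ((fc.q : ℕ) : 𝓞 K) ≠ 0 := mul_ne_zero hD0 hq0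
  have hgen := closure_tsupp_eq_top_of_dvd
    (dvd_mul_left ((fc.q : ℕ) : 𝓞 K) (lin hθ cc.D.1 cc.D.2.1 cc.D.2.2)) (fc.closure_q_eq_top_of_check hθ h3 hF hpr)
  have hDM : ∀ v : HeightOneSpectrum (𝓞 K), (3 : 𝓞 K) * (lin hθ cc.t.1 cc.t.2.1 cc.t.2.2) ^ 2 +
      2 * ((cc.A : ℤ) : 𝓞 K) * (lin hθ cc.t.1 cc.t.2.1 cc.t.2.2) + ((cc.B : ℤ) : 𝓞 K) ∈ v.asIdeal →
      (lin hθ cc.D.1 cc.D.2.1 cc.D.2.2 : 𝓞 K) * ((fc.q : ℕ) : 𝓞 K) ∈ v.asIdeal := by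
    intro v hv
    rw [hderiv] at hv
    exact Ideal.mul_mem_right _ _ hv
  have hDW₁ : (lin hθ cc.D.1 cc.D.2.1 cc.D.2.2 : 𝓞 K) ∉ (fc.W₁ hθ h3 hF hpr).asIdeal :=
    lin_not_mem_of_invCert hθ _ (W₁_asIdeal hθ h3 hF hpr) hdW1
  have hDW₂ : (lin hθ cc.D.1 cc.D.2.1 cc.D.2.2 : 𝓞 K) ∉ (fc.W₂ hθ h3 hF hpr).asIdeal :=
    lin_not_mem_of_invCert hθ _ (W₂_asIdeal hθ h3 hF hpr) hdW2
  -- the support `T = {W₁, W₂} ∪ codes`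
  set L := cc.codes.length with hL
  let Tf : Fin (L + 2) → HeightOneSpectrum (𝓞 K) := Matrix.vecCons (fc.W₁ hθ h3 hF hpr)
    (Matrix.vecCons (fc.W₂ hθ h3 hF hpr) fun i => codePrime hθ h3 hF hpr (cc.codes.get i))
  have hT : ∀ w : HeightOneSpectrum (𝓞 K),
      (lin hθ cc.D.1 cc.D.2.1 cc.D.2.2 : 𝓞 K) * ((fc.q : ℕ) : 𝓞 K) ∈ w.asIdeal → ∃ i, Tf i = w := by
    intro w hw
    rcases w.isPrime.mem_or_mem hw with hD | hqw
    · obtain ⟨l, hl, hldvd, hlw⟩ := exists_prime_dvd_norm_mem w hD0 hD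
      rw [natAbs_norm_lin_coords hirr hθ h3, hdn] at hldvd
      obtain ⟨a, ha, hla⟩ := (Prime.dvd_prod_iff hl.prime).mp hldvd
      obtain ⟨pe, hpe, rfl⟩ := List.mem_map.mp ha
      obtain ⟨hany, hrowcodes⟩ := hdnC pe hpe
      have hany' : (fc.primes.any fun e => e.p == pe.1) = true := by simpa [List.any_eq_true] using hany
      obtain ⟨hrow, hrowp⟩ := row_mem hany'
      have hpp : (fc.row pe.1).p.Prime := fc.prime_of_mem hpr hrow
      have hl_eq : l = pe.1 :=
        (Nat.prime_dvd_prime_iff_eq hl (hrowp ▸ hpp)).mp (hl.dvd_of_dvd_pow hla)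
      have hlw' : ((fc.row pe.1).p : 𝓞 K) ∈ w.asIdeal := by rw [hrowp, ← hl_eq]; exact hlw
      obtain ⟨C', hC', hw'⟩ :=
        exists_code_of_natCast_mem hirr hθ h3 hpp (fc.row_check_of_mem hF hrow).1 w hlw'
      rcases hrowcodes C' hC' with hmem | ⟨ci, -, hci, hinv⟩
      · obtain ⟨i, hi⟩ := List.mem_iff_get.mp hmem
        obtain ⟨hc1, hc2⟩ := hcodes _ (List.get_mem _ i)
        have hc1' : (fc.primes.any fun e => e.p == (cc.codes.get i).1) = true := by
          simpa [List.any_eq_true] using hc1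
        refine ⟨i.succ.succ, HeightOneSpectrum.ext ?_⟩
        simp only [Tf, Matrix.cons_val_succ]
        rw [codePrime_asIdeal hθ h3 hF hpr hc1' hc2, hi, hw']
      · exact absurd hD (lin_not_mem_of_invCert hθ w hw' hinv)
    · rcases eq_W₁_or_W₂ hθ h3 hF hpr w hqw with rfl | rfl
      · exact ⟨0, by simp [Tf]⟩
      · exact ⟨1, by simp [Tf]⟩
  -- the family (`fam fc cc`, written out: the binders `extra`, `hextra`, `hcount` mention it)
  let W : Fin (fam fc cc).length → 𝓞 K := fun j => lin hθ ((fam fc cc).get j).2.2.g.1 ((fam fc cc).get j).2.2.g.2.1 ((fam fc cc).get j).2.2.g.2.2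
  have hfam : ∀ j : Fin (fam fc cc).length, famCheck fc cc.D ((fam fc cc).get j) = true := fun j => hfamAll _ (List.get_mem _ j)
  have hW0 : ∀ j, W j ≠ 0 := fun j => lin_ne_zero_of_famCheck hθ h3 hF (hfam j)
  have hWval : ∀ j (v : HeightOneSpectrum (𝓞 K)),
      (lin hθ cc.D.1 cc.D.2.1 cc.D.2.2 : 𝓞 K) * ((fc.q : ℕ) : 𝓞 K) ∉ v.asIdeal →
        v.valuation K (algebraMap (𝓞 K) K (W j)) = 1 :=
    fun j v hv => valuation_eq_one_of_support _ _ (supp_of_famCheck hθ h3 hF hpr (hfam j)) v hv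
  obtain ⟨ρ, hlo, hhi⟩ := fc.exists_rho_of_check hθ h3 hF
  -- independence modulo squares: the parity certificate
  have hind : ∀ S : Finset (Fin (fam fc cc).length), IsSquare (∏ i ∈ S, algebraMap (𝓞 K) K (W i)) → S = ∅ := by
    intro S hS
    refine indep_of_parity_certificate (fun i => algebraMap (𝓞 K) K (W i)) (bit fc cc) ?_ hcert S hS
    intro k S' hS'
    have hS'' : IsSquare (∏ i ∈ S', W i) := isSquare_prod_of_isSquare_prod_coe _ hS'
    obtain ⟨k, hk⟩ := k
    rcases k with _ | _ | _ | k
    · have h := even_card_of_isSquare_real ρ (fun i => algebraMap (𝓞 K) K (W i))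
        (fun i => rho_ne_zero_of_famCheck hθ ρ hlo hhi hF (hfam i)) hS'
      convert h using 2
      refine Finset.filter_congr (fun i _ => ?_)
      exact sign_iff_of_famCheck hθ ρ hlo hhi hF (hfam i)
    · exact even_card_of_isSquare_valuation (fc.W₁ hθ h3 hF hpr) W hW0 _
        (fun i => by
          show ((!decide ((2 : ℤ) ∣ famL₁ ((fam fc cc).get i))) = true ↔ _)
          rw [log_W₁_of_famCheck hθ h3 hF hpr (hfam i)]; simp) hS'
    · exact even_card_of_isSquare_valuation (fc.W₂ hθ h3 hF hpr) W hW0 _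
        (fun i => by
          show ((!decide ((2 : ℤ) ∣ famL₂ ((fam fc cc).get i))) = true ↔ _)
          rw [log_W₂_of_famCheck hθ h3 hF hpr (hfam i)]; simp) hS'
    · have hk' : k < fc.chars.length := by omega
      have hch : fc.chars.getD k ((3 : ℕ), (0 : ℤ), (0 : ℤ)) ∈ fc.chars := by
        rw [List.getD_eq_getElem?_getD, List.getElem?_eq_getElem hk', Option.getD_some]
        exact List.getElem_mem hk'
      obtain ⟨h2, ψ, hψ⟩ := fc.exists_psi_of_check hθ h3 hF hpr hch
      haveI : Fact (fc.chars.getD k (3, 0, 0)).1.Prime := ⟨fc.char_prime hpr hch⟩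
      have h := even_card_filter_eulerBit hθ (ℓ := (fc.chars.getD k (3, 0, 0)).1) (by omega) ψ hψ
        (fun i => ((fam fc cc).get i).2.2.g) (fun i => not_dvd_evalInt_of_famCheck (hfam i) hch) hS''
      convert h using 2
      exact Finset.filter_congr (fun i _ => Iff.rfl)
  -- spanning of the `T`-units modulo squares
  have hodd : Odd (finrank ℚ K) := by rw [h3]; decide
  have hn : (fam fc cc).length = NumberField.Units.rank K + 1 + (L + 2) := by
    rw [fc.units_rank_of_check hθ h3 hF]
    simp only [fam, List.length_cons, List.length_map, hL]
    omega
  have hspan : ∀ u : K, u ≠ 0 →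
      (∀ v : HeightOneSpectrum (𝓞 K),
        (lin hθ cc.D.1 cc.D.2.1 cc.D.2.2 : 𝓞 K) * ((fc.q : ℕ) : 𝓞 K) ∉ v.asIdeal → v.valuation K u = 1) →
      ∃ U : Finset (Fin (fam fc cc).length), IsSquare (u * ∏ j ∈ U, algebraMap (𝓞 K) K (W j)) :=
    fun u hu huT => exists_isSquare_tunit_mul_prod hodd _ Tf hT hn (fun j => algebraMap (𝓞 K) K (W j))
      (fun j => RingOfIntegers.coe_ne_zero_iff.mpr (hW0 j)) hWval hind u hu huT
  -- the sieve is sound at rational points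
  have hθQ : ∀ x : ℚ, algebraMap ℚ K x ≠ algebraMap (𝓞 K) K (lin hθ cc.t.1 cc.t.2.1 cc.t.2.2) :=
    ne_of_powIndep (powIndep_algebraMap hirrF' haev h3)
  have hFrel : (lin hθ cc.t.1 cc.t.2.1 cc.t.2.2 : 𝓞 K) ^ 3 + cc.A * (lin hθ cc.t.1 cc.t.2.1 cc.t.2.2) ^ 2 +
      cc.B * (lin hθ cc.t.1 cc.t.2.1 cc.t.2.2) + cc.C = 0 := by
    apply RingOfIntegers.coe_injective
    simpa only [map_add, map_mul, map_pow, map_intCast, _root_.map_zero] using MonicCubic.theta_rel haev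
  have hadm0 : (adm fc cc ∅ ∅ && extra ∅) = true := by
    rw [Bool.and_eq_true]
    refine ⟨?_, hextra0⟩
    simp only [adm, Bool.and_eq_true, decide_eq_true_eq, Finset.filter_empty, Finset.card_empty]
    exact ⟨⟨admStdQ_empty _ hQ _ _ _ _, by decide⟩, by decide⟩
  -- `y ≠ 0` at rational points (`F` irreducible of degree `3` has no rational root)
  have hy0 : ∀ x y : ℚ, y ^ 2 = x ^ 3 + cc.A * x ^ 2 + cc.B * x + cc.C → y ≠ 0 := by
    intro x y hxy hy
    rw [hy] at hxy
    have hroot : (MonicCubic.polyQ cc.A cc.B cc.C).IsRoot x := by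
      rw [MonicCubic.polyQ_eq, Polynomial.IsRoot.def]
      simp only [eval_add, eval_mul, eval_pow, eval_X, eval_C]
      linear_combination -hxy
    have h1 : (MonicCubic.polyQ cc.A cc.B cc.C).natDegree = 1 :=
      Polynomial.natDegree_eq_of_degree_eq_some (Polynomial.degree_eq_one_of_irreducible_of_root hirrF' hroot)
    have h3' : (MonicCubic.polyQ cc.A cc.B cc.C).natDegree = 3 := MonicCubic.natDegree_polyQ cc.A cc.B cc.C
    omega
  have hadm : ∀ x y : ℚ, y ^ 2 = x ^ 3 + cc.A * x ^ 2 + cc.B * x + cc.C →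
      ∀ (T : Finset (Fin 0)) (U : Finset (Fin (fam fc cc).length)),
        IsSquare ((algebraMap ℚ K x - algebraMap (𝓞 K) K (lin hθ cc.t.1 cc.t.2.1 cc.t.2.2)) *
          (∏ i ∈ T, algebraMap (𝓞 K) K (((fun i : Fin 0 => i.elim0 : Fin 0 → (𝓞 K)ˣ) i : (𝓞 K)ˣ) : 𝓞 K)) *
            ∏ j ∈ U, algebraMap (𝓞 K) K (W j)) → (adm fc cc T U && extra U) = true := by
    intro x y hxy T U hsq
    have hT0 : T = ∅ := Finset.eq_empty_of_isEmpty T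
    have hxU : extra U = true := by
      refine hextra _ W rfl (fun j => rfl) hW0 hFrel x y hxy (hy0 x y hxy) U ?_
      rw [hT0, Finset.prod_empty, mul_one] at hsq
      exact hsq
    have hcof := cofactor_pos_of_disc_neg (rho_theta_root ρ haev) hdisc
    have h1 : admStd (fun i : Fin 0 => i.elim0) (famNorm fc cc) (fun i : Fin 0 => i.elim0) (famSign fc cc) T U =
        true :=
      admStd_sound hirrF' haev h3 ρ hcof (w := fun i : Fin 0 => algebraMap (𝓞 K) K
          (((fun i : Fin 0 => i.elim0 : Fin 0 → (𝓞 K)ˣ) i : (𝓞 K)ˣ) : 𝓞 K))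
        (g := fun j => algebraMap (𝓞 K) K (W j)) (fun i => i.elim0)
        (fun j => RingOfIntegers.coe_ne_zero_iff.mpr (hW0 j)) (fun i => i.elim0)
        (fun j => norm_of_famCheck hθ h3 hF) (fun i => i.elim0)
        (fun j => sign_iff_of_famCheck hθ ρ hlo hhi hF (hfam j)) x y hxy T U hsq
    have h2 := valRow_sound hFrel hθQ (fc.W₁ hθ h3 hF hpr) (by rw [hderiv]; exact hDW₁) hW0
      (r := fun j => bitRow fc ((fam fc cc).get j) 1) (fun j => by
        show ((!decide ((2 : ℤ) ∣ famL₁ ((fam fc cc).get j))) = true ↔ _)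
        rw [show algebraMap (𝓞 K) K (W j) = ((W j : 𝓞 K) : K) from rfl,
          log_W₁_of_famCheck hθ h3 hF hpr (hfam j)]; simp) x y hxy T U hsq
    have h3' := valRow_sound hFrel hθQ (fc.W₂ hθ h3 hF hpr) (by rw [hderiv]; exact hDW₂) hW0
      (r := fun j => bitRow fc ((fam fc cc).get j) 2) (fun j => by
        show ((!decide ((2 : ℤ) ∣ famL₂ ((fam fc cc).get j))) = true ↔ _)
        rw [show algebraMap (𝓞 K) K (W j) = ((W j : 𝓞 K) : K) from rfl,
          log_W₂_of_famCheck hθ h3 hF hpr (hfam j)]; simp) x y hxy T U hsq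
    rw [Bool.and_eq_true]
    refine ⟨?_, hxU⟩
    simp only [adm, Bool.and_eq_true]
    exact ⟨⟨admStdQ_of_admStd hQ h1, h2⟩, h3'⟩
  exact mordellWeilRank_le_of_coverSet_cl_lt (A := cc.A) (B := cc.B) (C := cc.C)
    (⟨0, cc.A, 0, cc.B, cc.C⟩ : WeierstrassCurve ℚ) rfl rfl rfl rfl rfl hirrF' haev h3 hM0 hgen hDM hW0 hspan
    (Wu := fun i : Fin 0 => i.elim0) (adm := fun T U => adm fc cc T U && extra U) hadm0 hadm (s' := r) hcount

end Sound

end Summit.BirchSwinnertonDyer.BirchSwinnertonDyer.Rank2Observatory.TwoDescCl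

end
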